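import Literature.MathematicalPhysics.QuantumFieldTheory.LatticeGaugeDobrushinPoincare
import Literature.MathematicalPhysics.QuantumFieldTheory.LatticeGaugePlaquetteLowerBound
import Literature.MathematicalPhysics.QuantumLattice.LatticeGaugeDLRProofs
import Summits.Ventures.YMGap.RobustBall.LoopScreeningTilt
import HarnessLib

/-!
# Venture YMGap, track ROBUST-BALL — plaquette positivity I: source response at one link

HONEST FRAMING. WHAT THIS IS: a venture file (cell `pub-ymgap`, track Y2, seat rb-p2 g3): LATTICE
statements about Wilson's `SU(N)` lattice gauge theory on `ℤ^d` (DLR description `ymSpecification`,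
tree coupling `β`, weight `exp(-β S_W)`), valid at EVERY `β ≥ 0`. WHAT IT IS NOT: nothing about the
continuum limit, a spectral gap, or a Clay-sense mass gap.

This is part I of three (`PlaquettePositivityOneLink` → `PlaquettePositivityResample` →
`PlaquettePositivity`) proving that the mean plaquette of every infinite-volume limit state of the torus
Wilson states is bounded below EXPLICITLY at every coupling, `W_μ(1,1) ≥ β e^{-8(d-1)Nβ} V₀ / (2(d-1)N)`,
with no smallness condition on `β` (the tree's `PlaquetteLowerBound.exists_rectExpectation_one_one_ge`,
a first-order polymer expansion, needs `β ≤ β₂` with an astronomically small `β₂`). Consequence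
(part III and `WilsonStringTension`): the non-vanishing hypothesis of the tree's string-tension
theorem `exists_hasStringTension` is discharged at every `β > 0`.

CONTENT of part I (elementary; no expansion, no reflection positivity):
* `exp_neg_mul_integral_le_integral_tilted` — a tilt by an energy of oscillation `≤ D` costs at most
  `e^{-D}` on the mean of a nonnegative observable; `le_integral_of_isGibbsMeasure` — a mean floor
  through a DLR kernel (Georgii 2011, Remark 1.24);
* Haar integrals of the real character `Re tr ρ` on a special unitary model (`integral_haar_mul_mul`,
  `integral_reTr_mul_mul_eq_zero`, `integral_add_reTr_sq`: resampling one factor of a product restores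
  the full character variance `V₀ = PlaquetteLowerBound.charVariance ρ`);
* the one-link kernel at a link `e`: on the fibre it is Haar measure tilted by `β P + const`,
  `P(g) = ∑_{p ∋ e} Re tr(ρ(g) ρ(staple_p^e))` (`siteLaw_eq_tilted_sum`, from the tree's
  `wilsonBoundaryAction_singleton_update`), `P` has Haar mean zero, and the source-response bound
  `LoopScreening.integral_tilted_sub_integral_ge` gives
  **`γ_{e} P ≥ β e^{-2βM} ∫ P(g | ω)² dg`**, `M = N #{p ∋ e}` (`siteAvg_sum_plaquetteObs_ge`).

References: E. Seiler, LNP 159 (1982), §2; H.-O. Georgii, *Gibbs Measures and Phase Transitions*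
(2011), Remark 1.24. Everything here is proved; no definition, no named fact. [folklore]
-/

noncomputable section

open MeasureTheory Filter Topology Finset
open Literature.Probability.LatticeModels Literature.Probability.LatticeModels.DobrushinMetric
open Literature.MathematicalPhysics.QuantumLattice Literature.MathematicalPhysics.QuantumFieldTheory

namespace Summit.Ventures.YMGap.RobustBall

namespace PlaquettePositivity

/-! ### Part A — two abstract inequalities -/

section Abstract

variable {Ω : Type*} [MeasurableSpace Ω]

/-- **Tilting by an energy of oscillation `≤ D` costs at most a factor `e^{-D}` on the mean of a
nonnegative observable**: if `a ≤ φ ≤ a + D` a.e. and `0 ≤ X ≤ M`, then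
`e^{-D} ∫ X dν ≤ ∫ X d(ν.tilted φ)`. [folklore] -/
theorem exp_neg_mul_integral_le_integral_tilted {ν : Measure Ω} [IsProbabilityMeasure ν]
    {X : Ω → ℝ} (hX : Measurable X) (hX0 : ∀ ω, 0 ≤ X ω) {M : ℝ} (hM : ∀ ω, X ω ≤ M)
    {φ : Ω → ℝ} (hφm : Measurable φ) {a D : ℝ} (hφ : ∀ᵐ ω ∂ν, a ≤ φ ω ∧ φ ω ≤ a + D) :
    Real.exp (-D) * ∫ ω, X ω ∂ν ≤ ∫ ω, X ω ∂(ν.tilted φ) := by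
  have hi_X : Integrable X ν :=
    Integrable.of_bound hX.aestronglyMeasurable M (ae_of_all _ fun ω => by
      rw [Real.norm_eq_abs, abs_of_nonneg (hX0 ω)]; exact hM ω)
  have hi_exp : Integrable (fun ω => Real.exp (φ ω)) ν := by
    refine Integrable.of_bound hφm.exp.aestronglyMeasurable (Real.exp (a + D)) ?_
    filter_upwards [hφ] with ω hω
    rw [Real.norm_eq_abs, Real.abs_exp]
    exact Real.exp_le_exp.2 hω.2
  set Z : ℝ := ∫ ω, Real.exp (φ ω) ∂ν with hZ
  have hZpos : 0 < Z := integral_exp_pos hi_exp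
  have hZle : Z ≤ Real.exp (a + D) := by
    calc Z ≤ ∫ _, Real.exp (a + D) ∂ν := integral_mono_ae hi_exp (integrable_const _) (by
          filter_upwards [hφ] with ω hω using Real.exp_le_exp.2 hω.2)
      _ = Real.exp (a + D) := by simp
  have hdens : ∀ᵐ ω ∂ν, Real.exp (-D) ≤ Real.exp (φ ω) / Z := by
    filter_upwards [hφ] with ω hω
    rw [le_div_iff₀ hZpos]
    calc Real.exp (-D) * Z ≤ Real.exp (-D) * Real.exp (a + D) :=
          mul_le_mul_of_nonneg_left hZle (Real.exp_nonneg _)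
      _ = Real.exp a := by rw [← Real.exp_add]; ring_nf
      _ ≤ Real.exp (φ ω) := Real.exp_le_exp.2 hω.1
  rw [integral_tilted]
  simp_rw [smul_eq_mul, ← hZ]
  have hi_rhs : Integrable (fun ω => Real.exp (φ ω) / Z * X ω) ν := by
    have hM0 : ∀ ω, |X ω| ≤ M := fun ω => by rw [abs_of_nonneg (hX0 ω)]; exact hM ω
    refine Integrable.of_bound ((hφm.exp.div_const Z).mul hX).aestronglyMeasurable
      (Real.exp (a + D) / Z * M) ?_
    filter_upwards [hφ] with ω hω
    rw [Real.norm_eq_abs, abs_mul, abs_div, Real.abs_exp, abs_of_pos hZpos]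
    exact mul_le_mul (div_le_div_of_nonneg_right (Real.exp_le_exp.2 hω.2) hZpos.le) (hM0 ω)
      (abs_nonneg _) (by positivity)
  rw [← integral_const_mul]
  exact integral_mono_ae (hi_X.const_mul _) hi_rhs (by
    filter_upwards [hdens] with ω hω using mul_le_mul_of_nonneg_right hω (hX0 ω))

/-- **A mean floor from the DLR kernels.** If `μ` is a Gibbs measure for the specification `γ` and
every kernel `γ_Λ(· | η)` gives the bounded measurable observable `X` a mean `≥ v`, then
`∫ X dμ ≥ v` (DLR equation `∫ γ_Λ X dμ = ∫ X dμ`, Georgii 2011 Remark 1.24). [folklore] -/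
theorem le_integral_of_isGibbsMeasure {V S : Type*} [MeasurableSpace S]
    {γ : Specification V S} (hγ : IsSpecification γ) {μ : Measure (V → S)}
    (hμ : IsGibbsMeasure γ μ) (Λ : Finset V) {X : (V → S) → ℝ} (hX : Measurable X) {M : ℝ}
    (hM : ∀ σ, |X σ| ≤ M) {v : ℝ} (hv : ∀ η, v ≤ ∫ σ, X σ ∂(γ Λ η)) :
    v ≤ ∫ σ, X σ ∂μ := by
  haveI := hμ.isProbabilityMeasure
  have hi : Integrable X μ :=
    Integrable.of_bound hX.aestronglyMeasurable M (ae_of_all _ fun σ => by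
      rw [Real.norm_eq_abs]; exact hM σ)
  rw [← hμ.integral_integral_eq hγ Λ hi]
  calc v = ∫ _, v ∂μ := by simp
    _ ≤ ∫ η, ∫ σ, X σ ∂(γ Λ η) ∂μ := by
        refine integral_mono (integrable_const v) ?_ fun η => hv η
        have hsm : StronglyMeasurable fun η => ∫ σ, X σ ∂(γ Λ η) := by
          have hk : Measurable (γ Λ) := hγ.measurable_fun Λ
          let κ : ProbabilityTheory.Kernel (V → S) (V → S) := ⟨γ Λ, hk⟩
          exact hX.stronglyMeasurable.integral_kernel (κ := κ)
        refine Integrable.of_bound hsm.aestronglyMeasurable M (ae_of_all _ fun η => ?_)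
        haveI := hγ.isProbability Λ η
        have h := norm_integral_le_of_norm_le_const (μ := γ Λ η) (f := X) (C := M)
          (ae_of_all _ fun σ => by rw [Real.norm_eq_abs]; exact hM σ)
        simpa using h

end Abstract

/-! ### Part B — Haar integrals of the real character on a special unitary model -/

section Haar

variable {N : ℕ} {G : Type*} [Group G] [TopologicalSpace G] [IsTopologicalGroup G] [CompactSpace G]
  [MeasurableSpace G] [BorelSpace G] (ρ : G →* Matrix (Fin N) (Fin N) ℂ)

/-- Two-sided translates do not change Haar integrals: `∫ f(a g b) dg = ∫ f(g) dg`
(tree `measurePreserving_mul_mul_inv_haarProbability`). [folklore] -/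
theorem integral_haar_mul_mul {f : G → ℝ} (hf : Measurable f) (a b : G) :
    ∫ g, f (a * g * b) ∂haarProbability G = ∫ g, f g ∂haarProbability G := by
  have h := measurePreserving_mul_mul_inv_haarProbability (G := G) a b⁻¹
  have h2 := integral_map (μ := haarProbability G) h.measurable.aemeasurable
    (f := f) hf.aestronglyMeasurable
  rw [h.map_eq] at h2
  rw [h2]
  simp only [inv_inv]

/-- `∫ Re tr ρ(a g b) dg = 0` on a special unitary model with `N ≥ 2`
(`PlaquetteLowerBound.integral_reTr_eq_zero`). [folklore] -/
theorem integral_reTr_mul_mul_eq_zero (hρ : IsSpecialUnitaryModel ρ) (hN : 2 ≤ N) (a b : G) :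
    ∫ g, (ρ (a * g * b)).trace.re ∂haarProbability G = 0 := by
  have h := integral_haar_mul_mul (G := G) (f := fun g => (ρ g).trace.re)
    (continuous_trace_re ρ hρ.1).measurable a b
  rw [h]
  exact PlaquetteLowerBound.integral_reTr_eq_zero ρ hρ hN

/-- `∫ (Re tr ρ(a g b))² dg = V₀ = charVariance ρ`. [folklore] -/
theorem integral_reTr_mul_mul_sq (hρ : Continuous ρ) (a b : G) :
    ∫ g, (ρ (a * g * b)).trace.re ^ 2 ∂haarProbability G = PlaquetteLowerBound.charVariance ρ := by
  have h := integral_haar_mul_mul (G := G) (f := fun g => (ρ g).trace.re ^ 2)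
    ((continuous_trace_re ρ hρ).pow 2).measurable a b
  rw [h]
  rfl

/-- **Resampling one factor of a product restores the full character variance**: for a constant
`A` and fixed `a, b`, `∫ (A + Re tr ρ(a h b))² dh = A² + V₀`. [folklore] -/
theorem integral_add_reTr_sq (hρ : IsSpecialUnitaryModel ρ) (hN : 2 ≤ N) (A : ℝ) (a b : G) :
    ∫ h, (A + (ρ (a * h * b)).trace.re) ^ 2 ∂haarProbability G =
      A ^ 2 + PlaquetteLowerBound.charVariance ρ := by
  have hc : Continuous fun h : G => (ρ (a * h * b)).trace.re :=
    (continuous_trace_re ρ hρ.1).comp ((continuous_const.mul continuous_id).mul continuous_const)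
  have hi1 : Integrable (fun h : G => (ρ (a * h * b)).trace.re) (haarProbability G) :=
    hc.integrable_of_hasCompactSupport (HasCompactSupport.of_compactSpace _)
  have hi2 : Integrable (fun h : G => (ρ (a * h * b)).trace.re ^ 2) (haarProbability G) :=
    (hc.pow 2).integrable_of_hasCompactSupport (HasCompactSupport.of_compactSpace _)
  have hsplit : ∫ h, (A + (ρ (a * h * b)).trace.re) ^ 2 ∂haarProbability G =
      ∫ h, (A ^ 2 + 2 * A * (ρ (a * h * b)).trace.re) + (ρ (a * h * b)).trace.re ^ 2
        ∂haarProbability G :=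
    integral_congr_ae (ae_of_all _ fun h => by ring)
  have hi3 : Integrable (fun h : G => 2 * A * (ρ (a * h * b)).trace.re) (haarProbability G) :=
    hi1.const_mul _
  have hi4 : Integrable (fun h : G => A ^ 2 + 2 * A * (ρ (a * h * b)).trace.re) (haarProbability G) :=
    (integrable_const _).add hi3
  rw [hsplit, integral_add hi4 hi2, integral_add (integrable_const _) hi3, integral_const_mul,
    integral_reTr_mul_mul_eq_zero ρ hρ hN, integral_reTr_mul_mul_sq ρ hρ.1]
  simp

end Haar

/-! ### Part C — the one-link kernel: source response at a link -/

section OneLink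

variable {d N : ℕ} {G : Type*} [Group G] [TopologicalSpace G] [IsTopologicalGroup G] [CompactSpace G]
  [MeasurableSpace G] [BorelSpace G] (ρ : G →* Matrix (Fin N) (Fin N) ℂ)

omit [TopologicalSpace G] [IsTopologicalGroup G] [CompactSpace G] [MeasurableSpace G] [BorelSpace G] in
/-- **The plaquette sum through a link on the one-link fibre** is the staple form
`∑_{p ∋ e} Re tr(ρ(g) ρ(staple_p^e(ω)))` (`re_trace_holonomy_update`). [folklore] -/
theorem sum_plaquetteObs_update (hρu : ∀ g, ρ g ∈ Matrix.unitaryGroup (Fin N) ℂ)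
    (e : Literature.MathematicalPhysics.QuantumLattice.ZdEdge d) (ω : LGConfig d G) (g : G) :
    ∑ p ∈ plaquettesTouching {e}, plaquetteObs ρ p.1 p.2.1.1 p.2.1.2 (Function.update ω e g) =
      ∑ p ∈ plaquettesTouching {e}, (ρ g * ρ (staple p e ω)).trace.re := by
  refine Finset.sum_congr rfl fun p hp => ?_
  simp only [plaquetteObs]
  exact re_trace_holonomy_update ρ hρu (mem_plaquettesTouching_singleton.1 hp) ω g

omit [TopologicalSpace G] [IsTopologicalGroup G] [CompactSpace G] [MeasurableSpace G] [BorelSpace G] in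
/-- The staple form is bounded by `N` per plaquette. [folklore] -/
theorem abs_sum_re_trace_staple_le (hρu : ∀ g, ρ g ∈ Matrix.unitaryGroup (Fin N) ℂ)
    (e : Literature.MathematicalPhysics.QuantumLattice.ZdEdge d) (ω : LGConfig d G) (g : G) :
    |∑ p ∈ plaquettesTouching {e}, (ρ g * ρ (staple p e ω)).trace.re| ≤
      (plaquettesTouching {e}).card * N := by
  calc |∑ p ∈ plaquettesTouching {e}, (ρ g * ρ (staple p e ω)).trace.re|
      ≤ ∑ p ∈ plaquettesTouching {e}, |(ρ g * ρ (staple p e ω)).trace.re| :=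
        Finset.abs_sum_le_sum_abs _ _
    _ ≤ ∑ _p ∈ plaquettesTouching {e}, (N : ℝ) := Finset.sum_le_sum fun p _ => by
        rw [← map_mul]; exact abs_re_trace_le_of_mem_unitaryGroup (hρu _)
    _ = (plaquettesTouching {e}).card * N := by rw [Finset.sum_const, nsmul_eq_mul]

omit [CompactSpace G] [MeasurableSpace G] [BorelSpace G] in
/-- The staple form is continuous in the link variable. [folklore] -/
theorem continuous_sum_re_trace_staple (hρ : Continuous ρ) (e : Literature.MathematicalPhysics.QuantumLattice.ZdEdge d) (ω : LGConfig d G) :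
    Continuous fun g : G => ∑ p ∈ plaquettesTouching {e}, (ρ g * ρ (staple p e ω)).trace.re := by
  refine continuous_finsetSum _ fun p _ => ?_
  simp_rw [← map_mul]
  exact (continuous_trace_re ρ hρ).comp (continuous_id.mul continuous_const)

/-- The staple form has Haar mean zero on a special unitary model, `N ≥ 2`. [folklore] -/
theorem integral_sum_re_trace_staple_eq_zero (hρ : IsSpecialUnitaryModel ρ) (hN : 2 ≤ N)
    (e : Literature.MathematicalPhysics.QuantumLattice.ZdEdge d) (ω : LGConfig d G) :
    ∫ g, ∑ p ∈ plaquettesTouching {e}, (ρ g * ρ (staple p e ω)).trace.re ∂haarProbability G = 0 := by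
  rw [integral_finsetSum _ fun p _ => ?_]
  · refine Finset.sum_eq_zero fun p _ => ?_
    have h := integral_reTr_mul_mul_eq_zero ρ hρ hN 1 (staple p e ω)
    simp_rw [one_mul, map_mul] at h
    exact h
  · simp_rw [← map_mul]
    exact ((continuous_trace_re ρ hρ.1).comp (continuous_id.mul continuous_const)).integrable_of_hasCompactSupport
      (HasCompactSupport.of_compactSpace _)

variable [SecondCountableTopology G]

/-- **The one-link law as a tilt by the plaquette sum**: the single-site law of the Wilson
specification at `e` is Haar measure tilted by `β ∑_{p ∋ e} Re tr(ρ(g) ρ(staple_p))` (the constant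
`-β N #{p ∋ e}` of `wilsonBoundaryAction_singleton_update` drops out of the tilt). [folklore] -/
theorem siteLaw_eq_tilted_sum (hρ : Continuous ρ) (hρu : ∀ g, ρ g ∈ Matrix.unitaryGroup (Fin N) ℂ)
    (β : ℝ) (e : Literature.MathematicalPhysics.QuantumLattice.ZdEdge d) (ω : LGConfig d G) :
    siteLaw (ymSpecification ρ β) e ω =
      (haarProbability G).tilted fun g =>
        β * ∑ p ∈ plaquettesTouching {e}, (ρ g * ρ (staple p e ω)).trace.re := by
  rw [siteLaw_ymSpecification_eq_tilted_haar ρ hρ β e ω]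
  have h : (fun g => -β * wilsonBoundaryAction ρ {e} (Function.update ω e g)) = fun g =>
      (-(β * ((plaquettesTouching {e}).card * (N : ℝ)))) +
        β * ∑ p ∈ plaquettesTouching {e}, (ρ g * ρ (staple p e ω)).trace.re := by
    funext g
    rw [wilsonBoundaryAction_singleton_update ρ hρu e ω g, Finset.sum_sub_distrib, Finset.sum_const,
      nsmul_eq_mul]
    ring
  rw [h]
  exact tilted_const_add_eq _ _ _

variable [T2Space G]

/-- **Source response at one link.** For every boundary condition `ω`, the one-link kernel of the
Wilson specification at `e` gives the plaquette sum `P_e = ∑_{p ∋ e} Re tr ρ(U_p)` a mean at least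
`β e^{-2βM} ∫ P_e(g | ω)² dg`, `M = N #{p ∋ e}` (Haar mean zero + the source-response bound
`LoopScreening.integral_tilted_sub_integral_ge`). [folklore] -/
theorem siteAvg_sum_plaquetteObs_ge (hρ : IsSpecialUnitaryModel ρ) (hN : 2 ≤ N) {β : ℝ}
    (hβ : 0 ≤ β) (e : Literature.MathematicalPhysics.QuantumLattice.ZdEdge d) (ω : LGConfig d G) :
    β * Real.exp (-(2 * β * ((plaquettesTouching {e}).card * N))) *
        ∫ g, (∑ p ∈ plaquettesTouching {e}, (ρ g * ρ (staple p e ω)).trace.re) ^ 2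
          ∂haarProbability G ≤
      siteAvg (ymSpecification ρ β) e
        (fun U => ∑ p ∈ plaquettesTouching {e}, plaquetteObs ρ p.1 p.2.1.1 p.2.1.2 U) ω := by
  have hu := IsSpecialUnitaryModel.mem_unitaryGroup ρ hρ
  have hγ := isSpecification_ymSpecification_of_t2Space (d := d) ρ hρ.1 β
  have hPm : Measurable fun U : LGConfig d G =>
      ∑ p ∈ plaquettesTouching {e}, plaquetteObs ρ p.1 p.2.1.1 p.2.1.2 U :=
    Finset.measurable_sum _ fun p _ => (continuous_plaquetteObs ρ hρ.1 _ _ _).measurable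
  rw [siteAvg_eq_integral_siteLaw hγ e hPm ω]
  simp_rw [sum_plaquetteObs_update ρ hu e ω]
  rw [siteLaw_eq_tilted_sum ρ hρ.1 hu β e ω]
  set R : G → ℝ := fun g => ∑ p ∈ plaquettesTouching {e}, (ρ g * ρ (staple p e ω)).trace.re
    with hR
  have hRm : Measurable R := (continuous_sum_re_trace_staple ρ hρ.1 e ω).measurable
  have hRb : ∀ g, |R g| ≤ (plaquettesTouching {e}).card * N := abs_sum_re_trace_staple_le ρ hu e ω
  have key := LoopScreening.integral_tilted_sub_integral_ge (μ := haarProbability G) hRm hRb hβ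
  have hmean : ∫ g, R g ∂haarProbability G = 0 := integral_sum_re_trace_staple_eq_zero ρ hρ hN e ω
  rw [hmean] at key
  simp only [sub_zero] at key
  exact key

end OneLink

end PlaquettePositivity

end Summit.Ventures.YMGap.RobustBall
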